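import Summits.Ventures.DiscreteObjects.Hadamard.Order4Nega

/-!
# H(668): block-circulant and nega-block-circulant shapes are EXCLUDED (search-facing corollaries, kernel)

Framing: lottery ticket; floor = certified bounds/negative ranges.

Cell pub-namedobj (venture DiscreteObjects), target (H), hadamard gen 13.  Array-language corollaries of the final involution census
(`no_hadamard668_unsigned_fpf_involution`, gen 13) and of the order-4 theorem (`no_hadamard668_nega4_blockform`, gen 13), for
PLAN-H's structured families.  With arbitrary `±1` blocks (`A, B, C, D` of order `167`, resp. `A, B` of order `334`; no
circulant / symmetric / commuting assumption on the blocks):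
* `no_hadamard668_block_circulant2` — **no Hadamard matrix of order 668 has the form `[[A, B], [B, A]]`** (the block swap is an
  unsigned fixed-point-free involution pair; classically: `(A + B)/2` would be a `W(334, 167)`, `334 ≡ 2 (mod 4)`, `167 ≠ a² + b²`);
* `no_hadamard668_block_circulant4` — **none has the form `[[A,B,C,D],[D,A,B,C],[C,D,A,B],[B,C,D,A]]`** (block-circulant: its square
  shift is an unsigned fixed-point-free involution);
* `no_hadamard668_nega_block_circulant4` — **none has the form `[[A,B,C,D],[−D,A,B,C],[−C,−D,A,B],[−B,−C,−D,A]]`**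
  (nega-block-circulant = `Σ X_k ⊗ J^k` with `J` the nega 4-cycle, `J⁴ = −1`): this is exactly the block normal form excluded by the
  `√2`-folding (`no_hadamard668_nega4_blockform`).
NOT excluded (consistent with the census): the two-negacirculant / complex shape `[[A, B], [−B, A]]` (a NEGA fixed-point-free
involution), the Williamson / quaternion array `[[A,B,C,D],[−B,A,−D,C],[−C,D,A,−B],[−D,−C,B,A]]`, the Goethals–Seidel array.
Statements are about matrices indexed by `Fin k × R` with the block pattern given entrywise (`H (p, c) (q, c') = ± X (q − p) c c'`).
Ours; no `sorry`.
-/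

namespace Summit.Ventures.DiscreteObjects.Hadamard

open Finset BigOperators Matrix

open Literature.Combinatorics.Designs.GoethalsSeidel (IsHadamardMatrix)

variable {R : Type*} [Fintype R] [DecidableEq R]

/-- **No H(668) of the form `[[A, B], [B, A]]`** (`A, B` arbitrary `334 × 334` blocks): the block pattern
`H (p, c) (q, c') = X (q − p) c c'` on `Fin 2 × R`, `|R| = 334`, is incompatible with `H Hᵀ = 668·1`. -/
theorem no_hadamard668_block_circulant2 (hR : Fintype.card R = 334) (X : Fin 2 → Matrix R R ℤ)
    (H : Matrix (Fin 2 × R) (Fin 2 × R) ℤ) (hX : ∀ p q c c', H (p, c) (q, c') = X (q - p) c c')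
    (hH : IsHadamardMatrix H) : False := by
  have hcard : Fintype.card (Fin 2 × R) = 668 := by rw [Fintype.card_prod, Fintype.card_fin, hR]
  set τ : Equiv.Perm (Fin 2 × R) := (finRotate 2).prodCongr (Equiv.refl R) with hτdef
  have hτ : ∀ x : Fin 2 × R, τ x = (x.1 + 1, x.2) := by
    rintro ⟨p, c⟩
    rw [hτdef, Equiv.prodCongr_apply, Prod.map_apply]
    simp [finRotate_apply]
  have haut : IsSignedAut H τ τ (fun _ => 1) (fun _ => 1) := by
    refine ⟨fun _ => Or.inl rfl, fun _ => Or.inl rfl, ?_⟩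
    rintro ⟨p, c⟩ ⟨q, c'⟩
    rw [hτ, hτ, hX, hX, one_mul, one_mul, add_sub_add_right_eq_sub]
  have hinv : ∀ x, τ (τ x) = x := by
    rintro ⟨p, c⟩
    rw [hτ, hτ]
    refine Prod.ext ?_ rfl
    show p + 1 + 1 = p
    fin_cases p <;> decide
  have hfpf : ∀ x, τ x ≠ x := by
    rintro ⟨p, c⟩ h
    rw [hτ] at h
    have h1 : p + 1 = p := congrArg Prod.fst h
    fin_cases p <;> simp at h1
  exact no_hadamard668_unsigned_fpf_involution hH hcard haut hinv hinv hfpf hfpf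

/-- **No H(668) of the form `[[A,B,C,D],[D,A,B,C],[C,D,A,B],[B,C,D,A]]`** (block-circulant, `A, B, C, D` arbitrary `167 × 167`
blocks): the pattern `H (p, c) (q, c') = X (q − p) c c'` on `Fin 4 × R`, `|R| = 167`, is incompatible with `H Hᵀ = 668·1` (the
double shift is an unsigned fixed-point-free involution pair). -/
theorem no_hadamard668_block_circulant4 (hR : Fintype.card R = 167) (X : Fin 4 → Matrix R R ℤ)
    (H : Matrix (Fin 4 × R) (Fin 4 × R) ℤ) (hX : ∀ p q c c', H (p, c) (q, c') = X (q - p) c c')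
    (hH : IsHadamardMatrix H) : False := by
  have hcard : Fintype.card (Fin 4 × R) = 668 := by rw [Fintype.card_prod, Fintype.card_fin, hR]
  set τ : Equiv.Perm (Fin 4 × R) := ((finRotate 4) ^ 2).prodCongr (Equiv.refl R) with hτdef
  have hτ : ∀ x : Fin 4 × R, τ x = (x.1 + 2, x.2) := by
    rintro ⟨p, c⟩
    rw [hτdef, Equiv.prodCongr_apply, Prod.map_apply]
    refine Prod.ext ?_ rfl
    show (finRotate 4 ^ 2) p = p + 2
    rw [pow_two, Equiv.Perm.mul_apply, finRotate_apply, finRotate_apply]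
    fin_cases p <;> decide
  have haut : IsSignedAut H τ τ (fun _ => 1) (fun _ => 1) := by
    refine ⟨fun _ => Or.inl rfl, fun _ => Or.inl rfl, ?_⟩
    rintro ⟨p, c⟩ ⟨q, c'⟩
    rw [hτ, hτ, hX, hX, one_mul, one_mul, add_sub_add_right_eq_sub]
  have hinv : ∀ x, τ (τ x) = x := by
    rintro ⟨p, c⟩
    rw [hτ, hτ]
    refine Prod.ext ?_ rfl
    show p + 2 + 2 = p
    fin_cases p <;> decide
  have hfpf : ∀ x, τ x ≠ x := by
    rintro ⟨p, c⟩ h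
    rw [hτ] at h
    have h1 : p + 2 = p := congrArg Prod.fst h
    fin_cases p <;> simp at h1
  exact no_hadamard668_unsigned_fpf_involution hH hcard haut hinv hinv hfpf hfpf

/-- **No H(668) of the form `[[A,B,C,D],[−D,A,B,C],[−C,−D,A,B],[−B,−C,−D,A]]`** (nega-block-circulant `Σ X_k ⊗ J^k`, `J` the
nega 4-cycle; `A, B, C, D = X 0, X 1, X 2, X 3` arbitrary `167 × 167` blocks): the pattern
`H (p, c) (q, c') = (−1)^{[q < p]} X (q − p) c c'` on `Fin 4 × R`, `|R| = 167`, is incompatible with `H Hᵀ = 668·1` — it is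
exactly the block normal form of `no_hadamard668_nega4_blockform` (invariance under the standard nega order-4 symmetry). -/
theorem no_hadamard668_nega_block_circulant4 (hR : Fintype.card R = 167) (X : Fin 4 → Matrix R R ℤ)
    (H : Matrix (Fin 4 × R) (Fin 4 × R) ℤ)
    (hX : ∀ p q c c', H (p, c) (q, c') = (if q.val < p.val then -1 else 1) * X (q - p) c c')
    (hH : IsHadamardMatrix H) : False := by
  set σ : Equiv.Perm (Fin 4 × R) := (finRotate 4).prodCongr (Equiv.refl R) with hσdef
  have hσ : ∀ x : Fin 4 × R, σ x = (x.1 + 1, x.2) := by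
    rintro ⟨p, c⟩
    rw [hσdef, Equiv.prodCongr_apply, Prod.map_apply]
    simp [finRotate_apply]
  have haut : IsSignedAut H σ σ (fun x => if x.1 = 3 then -1 else 1) (fun x => if x.1 = 3 then -1 else 1) := by
    refine ⟨fun x => ?_, fun x => ?_, ?_⟩
    · dsimp only; split_ifs <;> simp
    · dsimp only; split_ifs <;> simp
    · rintro ⟨p, c⟩ ⟨q, c'⟩
      rw [hσ, hσ, hX, hX, add_sub_add_right_eq_sub]
      dsimp only
      fin_cases p <;> fin_cases q <;> simp
  exact no_hadamard668_nega4_blockform hR H hH haut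

end Summit.Ventures.DiscreteObjects.Hadamard
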